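import Mathlib
import Summits.Ventures.HodgeRepro.OcticCMPointSixSign
import Summits.Ventures.HodgeRepro.OcticCMPointS3ConjSymplectic

/-!
# OcticCMPointEightNormClass — the conjugate-symplectic transcription is trivial on norms, and a norm has a square residue

Blind re-derivation cell `pub-hodge-repro`, seat night-2 (gen 5).  Target tree path
`lean/Summits/Ventures/HodgeRepro/OcticCMPointEightNormClass.lean`.  A consistency check of gen 4/5's transcription
`ConjSymplecticEight` (`ρ(u) = χ_quad(res u)` on the `σ`-fixed units of `𝒪/𝔭⁸`) against the one property the
norm-residue symbol `ω_{K_v/k_v}` must have on units — triviality on norms `N(v) = v σ(v)`: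

* `res` is multiplicative (`res_mul`: the constant coordinate of a product is `u₀ v₀` modulo `5`, since
  `w⁴ = −5w² − 5`) and `σ`-invariant (`res_conj`), so `res(v σ(v)) = (res v)²` (`res_norm_eq_sq`), a non-zero SQUARE
  in `𝔽₅` for a unit `v`; hence `χ_quad(res(N v)) = 1` (`quadChar5C_res_norm`) and
  **`ConjSymplecticEight ρ → ρ(v σ(v)) = 1`** (`conjSymplecticEight_norm`).
* Numerically (NIGHT-2-g5.md §3) the norms have INDEX 2 in the `σ`-fixed units at the ramified place (`500 : 250` on
  `𝒪/𝔭⁸`) and index `1` at the inert place (`192 : 192` on `GR(16,4)`, the Norm module): `χ_quad ∘ res` is the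
  non-trivial character of `𝒪_k^×/N 𝒪_K^×`, which is why a sign appears at `𝔭` and none at `𝔮`.

**What this is not.**  The surjectivity `N(𝒪_K^×) = ker(χ_quad ∘ res)` is NOT proved here.  Nothing here says
anything about the status of the Hodge conjecture for CM abelian varieties, which is NOT proved.
-/

set_option autoImplicit false

noncomputable section

open Polynomial Classical

namespace Summit.Ventures.HodgeRepro.PeriodCloser

namespace EightModel

open GaussSumStability SixModel

/-- The constant coordinate of a product: `(u v)₀ = u₀ v₀ − 5 (u₁ v₃ + u₂ v₂ + u₃ v₁) + 25 (…)`; modulo `5` it is `u₀ v₀`. -/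
theorem coord_zero_mul (u v : R8) :
    c5 (b4.repr (u * v) 0) = c5 (b4.repr u 0) * c5 (b4.repr v 0) := by
  have hu := eq_comb u
  have hv := eq_comb v
  set u0 := b4.repr u 0; set u1 := b4.repr u 1; set u2 := b4.repr u 2; set u3 := b4.repr u 3
  set v0 := b4.repr v 0; set v1 := b4.repr v 1; set v2 := b4.repr v 2; set v3 := b4.repr v 3
  have h4 := w_pow_four
  have h5 := w_pow_five
  have h6 := w_pow_six
  have hprod : u * v = (u0 * v0 + 20 * (u1 * v3 + u2 * v2 + u3 * v1)) • (1 : R8) +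
      (u0 * v1 + u1 * v0 + 20 * (u2 * v3 + u3 * v2)) • w +
      (u0 * v2 + u1 * v1 + u2 * v0 + 20 * (u1 * v3 + u2 * v2 + u3 * v1) + 20 * (u3 * v3)) • w ^ 2 +
      (u0 * v3 + u1 * v2 + u2 * v1 + u3 * v0 + 20 * (u2 * v3 + u3 * v2)) • w ^ 3 := by
    rw [hu, hv]
    have h20 : algebraMap (ZMod 25) R8 20 = 20 := map_ofNat _ _
    simp only [smul_eq_num, map_add, map_mul, h20]
    linear_combination (algebraMap (ZMod 25) R8 u1 * algebraMap (ZMod 25) R8 v3 +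
        algebraMap (ZMod 25) R8 u2 * algebraMap (ZMod 25) R8 v2 +
        algebraMap (ZMod 25) R8 u3 * algebraMap (ZMod 25) R8 v1) * h4 +
      (algebraMap (ZMod 25) R8 u2 * algebraMap (ZMod 25) R8 v3 +
        algebraMap (ZMod 25) R8 u3 * algebraMap (ZMod 25) R8 v2) * h5 +
      (algebraMap (ZMod 25) R8 u3 * algebraMap (ZMod 25) R8 v3) * h6
  rw [hprod, coords_comb]
  show c5 (u0 * v0 + 20 * (u1 * v3 + u2 * v2 + u3 * v1)) = c5 u0 * c5 v0
  have h20 : ∀ x : ZMod 25, c5 (20 * x) = 0 := by decide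
  rw [map_add, map_mul, h20, add_zero]

/-- **`res` is multiplicative.** -/
theorem res_mul (u v : R8) : res (u * v) = res u * res v := coord_zero_mul u v

/-- **`res` is `σ`-invariant** (the constant coordinate of `σ(u)` is that of `u`). -/
theorem res_conj (u : R8) : res (conj u) = res u := by
  unfold res
  have h := conj_sub_self u
  have : conj u = u - 2 * oddPart u := by linear_combination h
  rw [this]
  have hodd : b4.repr (2 * oddPart u) 0 = 0 := by
    unfold oddPart
    rw [show (2 : R8) * (b4.repr u 1 • w + b4.repr u 3 • w ^ 3) = (0 : ZMod 25) • (1 : R8) + (2 * b4.repr u 1) • w +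
      (0 : ZMod 25) • w ^ 2 + (2 * b4.repr u 3) • w ^ 3 by
        simp only [smul_eq_num, map_mul, map_ofNat, map_zero]; ring, coords_comb]
    rfl
  rw [map_sub, Finsupp.coe_sub, Pi.sub_apply, hodd, sub_zero]

/-- **The residue of a norm is a square**: `res(v σ(v)) = (res v)²`. -/
theorem res_norm_eq_sq (v : R8) : res (v * conj v) = res v ^ 2 := by
  rw [res_mul, res_conj, sq]

/-- `χ_quad` of a non-zero square is `1`. -/
theorem quadChar5C_sq_eq_one (c : ZMod 5) (hc : c ≠ 0) : quadChar5C (c ^ 2) = 1 := by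
  rw [map_pow, sq]
  exact quadChar5C_sq c hc

/-- **`χ_quad(res(N v)) = 1` for a unit `v`.** -/
theorem quadChar5C_res_norm (v : R8ˣ) : quadChar5C (res ((v : R8) * conj v)) = 1 := by
  rw [res_norm_eq_sq]
  exact quadChar5C_sq_eq_one _ (res_ne_zero_of_isUnit v)

/-- **The conjugate-symplectic transcription is trivial on norms**: `ConjSymplecticEight ρ → ρ(v σ(v)) = 1`
(the norm `v σ(v)` is a `σ`-fixed unit with square residue). -/
theorem conjSymplecticEight_norm (ρ : LocalChar R8) (hcs : ConjSymplecticEight ρ) (v : R8ˣ) :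
    ρ.unit ((v : R8) * conj v) = 1 := by
  have hu : IsUnit ((v : R8) * conj v) := v.isUnit.mul (by
    have := congrArg conj (Units.mul_inv v)
    rw [map_mul, map_one] at this
    exact IsUnit.of_mul_eq_one _ this)
  have hσ : conj ((v : R8) * conj v) = (v : R8) * conj v := by rw [map_mul, conj_conj, mul_comm]
  have := hcs hu.unit (by rw [IsUnit.unit_spec]; exact hσ)
  rw [IsUnit.unit_spec] at this
  rw [this, quadChar5C_res_norm]

/-- A conjugate-dual character is trivial on norms (for comparison: `ρ(v σ(v)) = ρ(v) ρ(v)⁻¹`), so the two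
descriptions agree on norms. -/
theorem conjDual_norm (ρ : LocalChar R8) (hσ : ∀ x, ρ.unit (conj x) = ρ.unit⁻¹ x) (v : R8ˣ) :
    ρ.unit ((v : R8) * conj v) = 1 := by
  rw [map_mul, hσ, MulChar.inv_apply_eq_inv']
  have h1 : ρ.unit (v : R8) * ρ.unit ((v⁻¹ : R8ˣ) : R8) = 1 := by rw [← map_mul, Units.mul_inv, map_one]
  exact mul_inv_cancel₀ (left_ne_zero_of_mul_eq_one h1)

end EightModel

end Summit.Ventures.HodgeRepro.PeriodCloser

end
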